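import Summits.NavierStokesRegularity.NavierStokesRegularity.Theses.PerpetualPump
import Summits.NavierStokesRegularity.NavierStokesRegularity.Theorems.PerpetualPumpAveragedTypeIBlowupTransfer
import Summits.NavierStokesRegularity.NavierStokesRegularity.Theorems.PerpetualPumpAveragedTypeIBlowupNoext
import Summits.NavierStokesRegularity.NavierStokesRegularity.Theorems.PerpetualPumpAveragedTypeIBlowupModeNormBound
import Summits.NavierStokesRegularity.NavierStokesRegularity.Theorems.PerpetualPumpAveragedTypeIBlowupSupBound
import Summits.NavierStokesRegularity.NavierStokesRegularity.Theorems.PerpetualPumpAveragedTypeIBlowupSynthField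
import Summits.NavierStokesRegularity.NavierStokesRegularity.Theorems.PerpetualPumpAveragedTypeIBlowupSynthMild
import Summits.NavierStokesRegularity.NavierStokesRegularity.Theorems.PerpetualPumpAveragedTypeIBlowupChainContinuation
import Summits.NavierStokesRegularity.NavierStokesRegularity.Theorems.PerpetualPumpAveragedTypeIBlowupThreshold
import Literature.Analysis.FluidPDE.TaoAveragedCascadeHolds
import Literature.Analysis.FluidPDE.TaoCascadeModeDuhamel
import HarnessLib.Audit

/-!
# Crux `PerpetualPump.AveragedTypeIBlowup` (stmt-NavierStokesRegularity-1835) — line `Sketch`, CLOSED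

`AveragedTypeIBlowup_of : Theses.PerpetualPump.AveragedTypeIBlowup` (the crux BY NAME) from the landed pieces:
the chain-level threshold theorem `stub_threshold` (…Threshold.lean: a pinned abrupt staircase of the seeded
graded Toda circuit on the exact Volterra chain, Type-I pace, non-extendable), the continuation dichotomy
`stub_chainContinuation`, the synthesis of the cascade field `stub_synthField`/`stub_synthMild` with the norm
bounds `stub_modeNormBound`/`stub_supBound`, non-extension `stub_noext`, and the transfer through Tao's
Theorem 3.2 `stub_transfer` (all in `Theorems/PerpetualPumpAveragedTypeIBlowup*.lean`, lead c0/c1 of line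
`Sketch`). [cite: Tao2016AveragedNS, §§3–6]
-/

set_option linter.dupNamespace false

noncomputable section

open MeasureTheory Set Filter Topology
open scoped ENNReal
open Literature.Analysis.FluidPDE Literature.Analysis.FluidPDE.Tao2016
open Literature.Analysis.FluidPDE.TaoCascade (quadTerm IsSymmetricCoeff IsCancellingCoeff)

namespace Summit.NavierStokesRegularity.NavierStokesRegularity.Theorems.PerpetualPumpAveragedTypeIBlowup

/-- Local notation for `ℝ³`. -/
local notation "ℝ³" => EuclideanSpace ℝ (Fin 3)

/-- **The chain-level Type-I blow-up from stubs 7–8** (formerly the single stub `chain`): the maximal chain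
solution of `stub_threshold` cannot stay bounded in the `H¹⁰` weight, by `stub_chainContinuation`. [cite: Tao2016AveragedNS, §4] -/
theorem chain_of_parts :
    ∀ ε₀ : ℝ, 0 < ε₀ → ε₀ ≤ 1 / 20 →
      ∃ (m : ℕ) (𝒟 : CascadeWaveletData ε₀ m) (α : Fin m → Fin m → Fin m → ℤ × ℤ × ℤ → ℝ),
        IsSymmetricCoeff α ∧ IsCancellingCoeff α ∧
        ∃ (i₀ : Fin m) (n₀ : ℤ) (A S : ℝ) (Y : Fin m → ℤ → ℝ → ℝ), 0 < S ∧
          (∀ i n, ContinuousOn (Y i n) (Ico 0 S)) ∧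
          (∀ i n t, n < n₀ → Y i n t = 0) ∧
          (∀ S' : ℝ, S' < S → ∃ C : ℝ, ∀ (i : Fin m) (n : ℤ), ∀ t ∈ Icc 0 S',
            (1 + ε₀) ^ ((20 : ℝ) * n) * |Y i n t| ≤ C) ∧
          (∀ (i : Fin m) (n : ℤ), ∀ t ∈ Ico 0 S,
            Y i n t = (if i = i₀ ∧ n = n₀ then A else 0) *
                (pairing (heat t (cascadeWavelet ε₀ (𝒟.ψ i) n)) (cascadeWavelet ε₀ (𝒟.ψ i) n)).re +
              ∫ s in (0 : ℝ)..t,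
                (pairing (heat (t - s) (cascadeWavelet ε₀ (𝒟.ψ i) n)) (cascadeWavelet ε₀ (𝒟.ψ i) n)).re *
                  quadTerm ε₀ α Y i n s) ∧
          (∃ M : ℝ, ∀ t ∈ Ico 0 S,
            (∑' p : Fin m × ℤ, ENNReal.ofReal ((1 + ε₀) ^ ((3 : ℝ) * p.2 / 2) *
              (Real.exp (-(4 * Real.pi ^ 2 * (1 + ε₀) ^ (2 * p.2) * t)) *
                  (if p.1 = i₀ ∧ p.2 = n₀ then |A| else 0) +
                ∫ s in (0 : ℝ)..t, |quadTerm ε₀ α Y p.1 p.2 s| *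
                  Real.exp (-(4 * Real.pi ^ 2 * (1 + ε₀) ^ (2 * p.2) * (t - s)))))) ≤
              ENNReal.ofReal (M / Real.sqrt (S - t))) ∧
          (∀ C : ℝ, ∃ t ∈ Ico 0 S, ∃ (i : Fin m) (n : ℤ), C < (1 + ε₀) ^ ((10 : ℝ) * n) * |Y i n t|) := by
  intro ε₀ hε₀ hε₀half
  have hε₀1 : ε₀ ≤ 1 := hε₀half.trans (by norm_num)
  obtain ⟨m, 𝒟, α, hsymm, hcanc, i₀, n₀, A, S, hS, ⟨Y, hcont, hlow, hdec, hchain, hM⟩, hmax⟩ :=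
    stub_threshold ε₀ hε₀ hε₀half
  refine ⟨m, 𝒟, α, hsymm, hcanc, i₀, n₀, A, S, Y, hS, hcont, hlow, hdec, hchain, hM, ?_⟩
  by_contra hbd
  push Not at hbd
  obtain ⟨C, hC⟩ := hbd
  obtain ⟨S', Y', hSS', hcont', hlow', hdec', hchain', -⟩ :=
    stub_chainContinuation hε₀ hε₀1 𝒟 α i₀ n₀ A S Y hS hcont hlow hdec hchain
      ⟨C, fun i n t ht => hC t ht i n⟩
  exact hmax ⟨S', Y', hSS', hcont', hlow', hdec', hchain'⟩

/-! ## Glue (proved) -/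

/-- Scalar multiples of divergence-free Schwartz fields are divergence free. [folklore] -/
theorem isDivFree_smul (A : ℝ) {ψ : SchwartzMap ℝ³ ℝ³} (hψ : VectorCalculus.IsDivFree ⇑ψ) :
    VectorCalculus.IsDivFree ⇑(A • ψ) := by
  intro x
  have hd : DifferentiableAt ℝ (⇑ψ) x := (ψ.differentiable).differentiableAt
  have hcoe : (⇑(A • ψ) : ℝ³ → ℝ³) = A • (⇑ψ) := rfl
  unfold VectorCalculus.divergence
  rw [hcoe, fderiv_const_smul hd A, ContinuousLinearMap.toLinearMap_smul, map_smul]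
  have h0 := hψ x
  unfold VectorCalculus.divergence at h0
  rw [h0, smul_zero]

/-- `quadTerm` only reads the coefficient family at the evaluation time. [folklore] -/
theorem quadTerm_congr {ε₀ : ℝ} {m : ℕ} (α : Fin m → Fin m → Fin m → ℤ × ℤ × ℤ → ℝ)
    {X X' : Fin m → ℤ → ℝ → ℝ} {s : ℝ} (h : ∀ (j : Fin m) (k : ℤ), X j k s = X' j k s) (i : Fin m) (n : ℤ) :
    quadTerm ε₀ α X i n s = quadTerm ε₀ α X' i n s := by
  unfold quadTerm
  simp only [h]

/-- **Composition of stubs 2–7**: the cascade-level Type-I blow-up at arbitrarily fine dyadic parameter (the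
hypothesis of `stub_transfer`). For `ε₁ > 0` take `ε₀ = min ε₁ ½`; `stub_chain` gives the circuit, the data and
the chain solution `Y`; `stub_synthField`/`stub_synthMild` the mild solution `u` with coefficients `Y`; the form is
a symmetric cancelling local cascade form (`isLocalCascadeForm_cascadeOperatorForm`, `cascadeOperatorForm_symm`,
`cascadeOperatorForm_cancel`, theorems of the tree); the rate follows from `stub_supBound`, `stub_modeNormBound` and
the chain's functional bound; non-extension from `stub_noext` and the chain's weighted blow-up. [cite: Tao2016AveragedNS, §4] -/
theorem cascadeTypeI_of_parts :
    ∀ ε₁ : ℝ, 0 < ε₁ → ∃ ε₀ : ℝ, 0 < ε₀ ∧ ε₀ ≤ ε₁ ∧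
      ∃ C : L2C → L2C → L2C → ℂ, IsLocalCascadeForm ε₀ C ∧
        (∀ u v w, MemH10df u → MemH10df v → MemH10df w → C u v w = C v u w) ∧
        (∀ u, MemH10df u → C u u u = 0) ∧
        ∃ u₀ : SchwartzMap ℝ³ ℝ³, VectorCalculus.IsDivFree ⇑u₀ ∧ ∃ S : ℝ, 0 < S ∧ ∃ u : ℝ → L2C,
          IsMildSolutionFor C (schwartzL2 u₀) (Ico 0 S) u ∧
          (∃ M : ℝ, ∀ t ∈ Ico 0 S, eLpNorm (u t) ⊤ volume ≤ ENNReal.ofReal (M / Real.sqrt (S - t))) ∧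
          ¬ ∃ S' : ℝ, S < S' ∧ ∃ v : ℝ → L2C,
            IsMildSolutionFor C (schwartzL2 u₀) (Ico 0 S') v ∧ ∀ t ∈ Ico 0 S, v t = u t := by
  intro ε₁ hε₁
  set ε₀ : ℝ := min ε₁ (1 / 20) with hε₀def
  have hε₀ : 0 < ε₀ := lt_min hε₁ (by norm_num)
  have hε₀half : ε₀ ≤ 1 / 20 := min_le_right _ _
  have hε₀1 : ε₀ ≤ 1 := hε₀half.trans (by norm_num)
  have hl : (0 : ℝ) < 1 + ε₀ := by positivity
  obtain ⟨m, 𝒟, α, hsymm, hcanc, i₀, n₀, A, S, Y, hS, hcont, hlow, hdec, hchain, ⟨M, hM⟩, hblow⟩ :=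
    chain_of_parts ε₀ hε₀ hε₀half
  obtain ⟨u, hmem, hcts, hsum⟩ := stub_synthField hε₀ hε₀1 𝒟 α i₀ n₀ A S Y hS hcont hlow hdec hchain
  obtain ⟨hmild, hcoeff⟩ :=
    stub_synthMild hε₀ hε₀1 𝒟 α i₀ n₀ A S Y hS hcont hlow hdec hchain u hmem hcts hsum
  obtain ⟨c, hc0, hc⟩ := stub_supBound hε₀ hε₀1 𝒟 α
  -- the datum as a Schwartz field
  set u₀ : SchwartzMap ℝ³ ℝ³ := A • schwartzWavelet hl (𝒟.ψ i₀) n₀ with hu₀def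
  have hdat : schwartzL2 u₀ = (A : ℂ) • cascadeWavelet ε₀ (𝒟.ψ i₀) n₀ := by
    rw [hu₀def, schwartzL2_smul, schwartzL2_schwartzWavelet]
  refine ⟨ε₀, hε₀, min_le_left _ _, cascadeOperatorForm ε₀ 𝒟.ψ α,
    isLocalCascadeForm_cascadeOperatorForm hε₀ hε₀1 𝒟 α,
    fun a b w _ _ _ => cascadeOperatorForm_symm ε₀ 𝒟.ψ hsymm a b w,
    fun a _ => cascadeOperatorForm_cancel ε₀ 𝒟.ψ hcanc a,
    u₀, isDivFree_smul A (isDivFree_schwartzWavelet hl (𝒟.isDivFree i₀) n₀), S, hS, u, ?_, ?_, ?_⟩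
  · rw [hdat]
    exact hmild
  · -- the Type-I rate
    refine ⟨c * M, fun t ht => ?_⟩
    have h1 := hc i₀ n₀ A S u hmild t ht
    have h2 : ∀ p : Fin m × ℤ,
        ENNReal.ofReal ((1 + ε₀) ^ ((3 : ℝ) * p.2 / 2) * ‖modeProjection 𝒟 p.1 p.2 (u t)‖) ≤
          ENNReal.ofReal ((1 + ε₀) ^ ((3 : ℝ) * p.2 / 2) *
            (Real.exp (-(4 * Real.pi ^ 2 * (1 + ε₀) ^ (2 * p.2) * t)) *
                (if p.1 = i₀ ∧ p.2 = n₀ then |A| else 0) +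
              ∫ s in (0 : ℝ)..t, |quadTerm ε₀ α Y p.1 p.2 s| *
                Real.exp (-(4 * Real.pi ^ 2 * (1 + ε₀) ^ (2 * p.2) * (t - s))))) := by
      intro p
      refine ENNReal.ofReal_le_ofReal (mul_le_mul_of_nonneg_left ?_ ?_)
      · have hb := stub_modeNormBound hε₀ hε₀1 𝒟 α i₀ n₀ A S u hmild p.1 p.2 t ht
        have hint : ∫ s in (0 : ℝ)..t, |quadTerm ε₀ α (modeCoeff 𝒟 u) p.1 p.2 s| *
              Real.exp (-(4 * Real.pi ^ 2 * (1 + ε₀) ^ (2 * p.2) * (t - s))) =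
            ∫ s in (0 : ℝ)..t, |quadTerm ε₀ α Y p.1 p.2 s| *
              Real.exp (-(4 * Real.pi ^ 2 * (1 + ε₀) ^ (2 * p.2) * (t - s))) := by
          refine intervalIntegral.integral_congr fun s hs => ?_
          rw [uIcc_of_le ht.1] at hs
          have hsI : s ∈ Ico 0 S := ⟨hs.1, hs.2.trans_lt ht.2⟩
          simp only [quadTerm_congr α (fun j k => hcoeff j k s hsI) p.1 p.2]
        rw [hint] at hb
        exact hb
      · exact Real.rpow_nonneg hl.le _
    calc eLpNorm (u t) ⊤ volume
        ≤ ENNReal.ofReal c * ∑' p : Fin m × ℤ,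
            ENNReal.ofReal ((1 + ε₀) ^ ((3 : ℝ) * p.2 / 2) * ‖modeProjection 𝒟 p.1 p.2 (u t)‖) := h1
      _ ≤ ENNReal.ofReal c * ENNReal.ofReal (M / Real.sqrt (S - t)) := by
          gcongr
          exact (ENNReal.tsum_le_tsum h2).trans (hM t ht)
      _ = ENNReal.ofReal (c * M / Real.sqrt (S - t)) := by
          rw [← ENNReal.ofReal_mul hc0, mul_div_assoc]
  · -- non-extension
    rw [hdat]
    refine stub_noext hε₀ 𝒟 (cascadeOperatorForm ε₀ 𝒟.ψ α) _ S u hmild fun K => ?_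
    obtain ⟨t, ht, i, n, hlt⟩ := hblow K
    exact ⟨t, ht, i, n, by rwa [hcoeff i n t ht]⟩

/-- **The crux, by name, from the seven stubs** — all seven `stub_*` theorems have landed sorry-free in the
sibling files `Theorems/PerpetualPumpAveragedTypeIBlowup*.lean` imported above, so the axiom closure of this
theorem is exactly `propext`, `Classical.choice`, `Quot.sound` (NO `sorryAx`): gate record p122984, re-checked
with `#print axioms` on 2026-08-17 (barrier entry `Literature.Barriers.NavierStokesRegularity.AveragedTypeIBlowup`)
and on 2026-08-25 (cell `pub/ns-blowup`, referee baseline and lean seat). ERRATUM 2026-08-25: the earlier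
wording of this docstring, "its axiom closure contains `sorryAx` exactly through the `stub_*` theorems",
described the skeleton stage of the line and is withdrawn; statement and proof are unchanged.
[cite: Tao2016AveragedNS, Thm. 1.5] -/
theorem AveragedTypeIBlowup_of : Theses.PerpetualPump.AveragedTypeIBlowup := by
  unfold Theses.PerpetualPump.AveragedTypeIBlowup
  exact stub_transfer cascadeTypeI_of_parts

end Summit.NavierStokesRegularity.NavierStokesRegularity.Theorems.PerpetualPumpAveragedTypeIBlowup

end
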